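import Summits.CriticalPhenomena.PercolationContinuityZ3.Theorems.Transplant.AutChartOrbitsCriticalContinuity
import Summits.CriticalPhenomena.PercolationContinuityZ3.Theorems.Transplant.BarlowPolytypes
import Summits.CriticalPhenomena.PercolationContinuityZ3.Theorems.Transplant.PlanarSkeletonFrmFrom1Px
import HarnessLib

/-!
# TARGET 2t′ (periodic form) IN THE TREE: `BarlowStackingCriticalContinuity` — NO PERCOLATION AT CRITICALITY ON EVERY PERIODIC CLOSE-PACKED POLYTYPE
# (2H = hcp, 3C = fcc, 4H = dhcp, 6H, 9R, …) — one application of the orbit theorem «AutChartOrbitsCriticalContinuity» with `p` orbits of the translations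

builds on p205010 (kernel theorem, internal audit signed; external expert review pending): the unconditional theorem of this file is an instance of
`AutChart.criticalContinuity_of_autSubgroup_finite_orbits` («AutChartOrbitsCriticalContinuity» §5, p493117, AUDIT-ORBIT signed 2026-08-27), which runs through the
aligned multi-type scaled node «SkelFrmScaledAlignedHoldsAll» (p490798) and so builds on p205010.  Lane `prim-bschramm`, seat `prim-bschramm-stmt` gen 33 (the stmt
lineage typed TARGET 2t′, «BarlowPolytypes» p265150, 2026-08-21).  Helper file (`--supports stmt-CriticalPhenomena-4575 --as helper`); PROOFS plus the bookkeeping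
definitions of the (c4) template («Z2PeriodicBilayerNonTransitive»: translation subgroup, transversal, chart); no node, no statement, no `@[conjecture]` is declared
or edited; nothing about the end-state node, the quasi-step rung or Conj. 4 in general is claimed.

THE GRAPHS.  `Barlow.contactGraph s` on `ℤ × ℤ × ℤ` (ball `(k, i, j)` = label `(i, j)` of the triangular layer `k`), `s` a Hägg sequence (`IsHaggSeq s`: the ideal
stacking of unit balls coded by `s`), PERIODIC: `s (k + p) = s k`, `0 < p`.  Contacts («BarlowContactGraph» `contactGraph_adj_iff`): the six in-layer neighbours
(`sixOffsets = {±(1,0), ±(0,1), ±(1,−1)}`) and three balls in each adjacent layer (`threeOffsets`); every contact moves each of the three labels by `≤ 1` (`Barlow.adj_bound`).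
THE PROOF (the (c4) template).  `A :=` the translations `(k, i, j) ↦ (k + p·c, i + a, j + b)` (`Barlow.translIso = shiftIso ∘ layerShiftIso`, both «BarlowPolytypes» §1;
`transl = translHom.range ≤ Aut`), `p` orbits, transversal `reps p = {(m, 0, 0) : m < p}` (the set of `Barlow.isQuasiTransitive`); chart `φ(k, i, j) := (i, j)`, translated
by `A`, constant on `reps`; `N := 1` (every contact moves the chart by a vector of sup-norm `≤ 1`); exact steps `± eᵢ` along the in-layer contacts `(k, i ± 1, j)`,
`(k, i, j ± 1)` at every ball; `Barlow.connected`, `Barlow.instLocallyFinite`.  Hence **`Barlow.criticalContinuity : ∀ v, θ_v(p_c) = 0`** for every periodic Hägg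
sequence, `Barlow.conj4` (`p_c < 1 ∧ θ_v(p_c) = 0`, the §6 front-end), `Barlow.drop`, and **`barlowStackingCriticalContinuity_holds : BarlowStackingCriticalContinuity`** —
TARGET 2t′ (periodic form) BY NAME.  Members: 2H = hcp (also `hcpOwnCriticalContinuity_holds` p484031 via the U_s node — the term
`hcpOwnCriticalContinuity_of_barlow barlowStackingCriticalContinuity_holds` is a second route, not restated here), 3C = fcc (also `Barlow.cubic_criticalContinuity` via
p205010's cubic frame), and 4H = dhcp, 6H, 9R, … (new in the tree).  WORDS: CUSTOMER of the orbit theorem (rule §59.3: no 'first' / 'outside every one-type node' —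
whether the non-vertex-transitive polytypes carry a one-type skeleton is not examined here); the APERIODIC Hägg sequences (not quasi-transitive, outside the hypothesis
class of Conj. 4, deliberately not typed in «BarlowPolytypes») are untouched.
* §1 the frames `translIso / translHom / transl`, `mem_transl`; §2 the transversal `reps`, `reps_trans`, `reps_cover`; §3 the chart and its four hypotheses
  (`chart_transl`, `chart_reps`, `chart_lip`, `chart_step`); §4 `Barlow.criticalContinuity / conj4 / drop`; §5 `barlowStackingCriticalContinuity_holds`.
[cite: BenjaminiSchramm1996, Conj. 4 (p. 75); §2 (almost transitive graphs)] [cite: ConwaySloane1999, Ch. 1 §1.3 and Ch. 4 §6.1] [cite: KozmaNitzan2024, §4 p. 16 (Lemma 8)]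
-/

noncomputable section

namespace Summit.CriticalPhenomena.PercolationContinuityZ3.Theorems.Transplant

open SimpleGraph Literature.Probability.LatticeModels Literature.Probability.Percolation
open Literature.MathematicalPhysics.StatisticalMechanics (IsHaggSeq sixOffsets)
open scoped Classical

namespace Barlow

variable {s : ℤ → ℤ} {p : ℕ}

/-! ## §1 The frames: the translations by `ℤ² × pℤ`, a subgroup of `Aut` -/

/-- **Translation by a period multiple and an in-layer vector** `(k, i, j) ↦ (k + p·c, i + a, j + b)`: an automorphism of the contact graph of a `p`-periodic ideal
stacking (`shiftIso` then `layerShiftIso`). [cite: BenjaminiSchramm1996, §2] -/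
def translIso (hs : IsHaggSeq s) (hp : ∀ k, s (k + p) = s k) (c a b : ℤ) : contactGraph s ≃g contactGraph s :=
  (shiftIso hs a b).trans (layerShiftIso hs (p * c) (periodic_mul hp c))

/-- `translIso … c a b (k, i, j) = (k + p·c, i + a, j + b)`. [folklore] -/
@[simp] theorem translIso_apply (hs : IsHaggSeq s) (hp : ∀ k, s (k + p) = s k) (c a b : ℤ) (v : ℤ × ℤ × ℤ) :
    translIso hs hp c a b v = (v.1 + p * c, v.2.1 + a, v.2.2 + b) := rfl

/-- The translations as a homomorphism `ℤ × ℤ² → Aut`. [folklore] -/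
def translHom (hs : IsHaggSeq s) (hp : ∀ k, s (k + p) = s k) : Multiplicative (ℤ × ℤ × ℤ) →* (contactGraph s ≃g contactGraph s) where
  toFun u := translIso hs hp (Multiplicative.toAdd u).1 (Multiplicative.toAdd u).2.1 (Multiplicative.toAdd u).2.2
  map_one' := RelIso.ext fun v => by simp
  map_mul' u u' := RelIso.ext fun v => by
    simp only [translIso_apply, toAdd_mul, Prod.fst_add, Prod.snd_add, RelIso.mul_apply, Prod.mk.injEq]
    exact ⟨by ring, by ring, by ring⟩

/-- `translHom u (k, i, j) = (k + p·u₀, i + u₁, j + u₂)`. [folklore] -/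
@[simp] theorem translHom_apply (hs : IsHaggSeq s) (hp : ∀ k, s (k + p) = s k) (u : Multiplicative (ℤ × ℤ × ℤ)) (v : ℤ × ℤ × ℤ) :
    translHom hs hp u v = (v.1 + p * (Multiplicative.toAdd u).1, v.2.1 + (Multiplicative.toAdd u).2.1, v.2.2 + (Multiplicative.toAdd u).2.2) := rfl

/-- **The frames**: the subgroup `A ≤ Aut` of the translations by `pℤ × ℤ²`. [cite: BenjaminiSchramm1996, §2] -/
def transl (hs : IsHaggSeq s) (hp : ∀ k, s (k + p) = s k) : Subgroup (contactGraph s ≃g contactGraph s) := (translHom hs hp).range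

/-- Membership in `A`: `α = translIso c a b` for some `c a b`. [folklore] -/
theorem mem_transl (hs : IsHaggSeq s) (hp : ∀ k, s (k + p) = s k) {α : contactGraph s ≃g contactGraph s} :
    α ∈ transl hs hp ↔ ∃ c a b : ℤ, translIso hs hp c a b = α := by
  rw [transl, MonoidHom.mem_range]
  constructor
  · rintro ⟨u, hu⟩
    exact ⟨(Multiplicative.toAdd u).1, (Multiplicative.toAdd u).2.1, (Multiplicative.toAdd u).2.2, hu⟩
  · rintro ⟨c, a, b, h⟩
    exact ⟨Multiplicative.ofAdd (c, a, b), h⟩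

/-! ## §2 The transversal: one ball in each of the layers `0, …, p − 1` -/

/-- The transversal `{(m, 0, 0) : m < p}` (the orbit representatives of `Barlow.isQuasiTransitive`). [folklore] -/
def reps (p : ℕ) : Finset (ℤ × ℤ × ℤ) := (Finset.range p).image fun m : ℕ => ((m : ℤ), (0 : ℤ), (0 : ℤ))

/-- Membership in the transversal. [folklore] -/
theorem mem_reps {r : ℤ × ℤ × ℤ} : r ∈ reps p ↔ ∃ m : ℕ, m < p ∧ ((m : ℤ), (0 : ℤ), (0 : ℤ)) = r := by
  unfold reps
  rw [Finset.mem_image]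
  simp only [Finset.mem_range]

/-- **`reps` meets every `A`-orbit at most once**: `m + p·c = m'` with `0 ≤ m, m' < p` forces `c = 0`. [folklore] -/
theorem reps_trans (hs : IsHaggSeq s) (hp : ∀ k, s (k + p) = s k) :
    ∀ r ∈ reps p, ∀ r' ∈ reps p, ∀ α ∈ transl hs hp, α r = r' → r = r' := by
  intro r hr r' hr' α hα h
  obtain ⟨c, a, b, rfl⟩ := (mem_transl hs hp).1 hα
  obtain ⟨m, hm, rfl⟩ := mem_reps.1 hr
  obtain ⟨m', hm', rfl⟩ := mem_reps.1 hr'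
  simp only [translIso_apply, zero_add, Prod.mk.injEq] at h
  obtain ⟨h1, -, -⟩ := h
  have hmZ : (m : ℤ) < p := by exact_mod_cast hm
  have hm'Z : (m' : ℤ) < p := by exact_mod_cast hm'
  have hp0 : (0 : ℤ) ≤ p := by exact_mod_cast p.zero_le
  have hc : c = 0 := by
    rcases lt_trichotomy c 0 with hc | hc | hc
    · have hb : (p : ℤ) * c ≤ (p : ℤ) * (-1) := mul_le_mul_of_nonneg_left (by omega) hp0
      exfalso
      have : (0 : ℤ) ≤ m' := by exact_mod_cast m'.zero_le
      linarith
    · exact hc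
    · have hb : (p : ℤ) * 1 ≤ (p : ℤ) * c := mul_le_mul_of_nonneg_left (by omega) hp0
      exfalso
      have : (0 : ℤ) ≤ m := by exact_mod_cast m.zero_le
      linarith
  subst hc
  rw [mul_zero, add_zero] at h1
  rw [h1]

/-- **`reps` meets every `A`-orbit**: `(k, i, j) = translIso (k / p) i j (k % p, 0, 0)`. [folklore] -/
theorem reps_cover (hs : IsHaggSeq s) (hp0 : 0 < p) (hp : ∀ k, s (k + p) = s k) :
    ∀ w : ℤ × ℤ × ℤ, ∃ α ∈ transl hs hp, ∃ r ∈ reps p, α r = w := by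
  rintro ⟨k, i, j⟩
  have hp0' : (0 : ℤ) < p := by exact_mod_cast hp0
  have h2 : 0 ≤ k % p := Int.emod_nonneg k hp0'.ne'
  refine ⟨translIso hs hp (k / p) i j, (mem_transl hs hp).2 ⟨_, _, _, rfl⟩, ((k % p), (0 : ℤ), (0 : ℤ)),
    mem_reps.2 ⟨(k % p).toNat, ?_, ?_⟩, ?_⟩
  · have h1 : k % p < p := Int.emod_lt_of_pos k hp0'
    omega
  · rw [Int.toNat_of_nonneg h2]
  · simp only [translIso_apply, zero_add]
    exact Prod.ext (Int.emod_add_mul_ediv k p) rfl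

/-! ## §3 The chart `(k, i, j) ↦ (i, j)` and its four hypotheses -/

/-- The chart: the in-layer label `(i, j)` as a point of `ℤ²`. [folklore] -/
def chart (v : ℤ × ℤ × ℤ) : Site 2 := ![v.2.1, v.2.2]

/-- `chart v 0 = i`. [folklore] -/
@[simp] theorem chart_apply_zero (v : ℤ × ℤ × ℤ) : chart v 0 = v.2.1 := rfl

/-- `chart v 1 = j`. [folklore] -/
@[simp] theorem chart_apply_one (v : ℤ × ℤ × ℤ) : chart v 1 = v.2.2 := rfl

/-- The chart is translated by `A`: `φ (α w) = φ w + (φ (α t) − φ t)` with `t = (0, 0, 0)`. [folklore] -/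
theorem chart_transl (hs : IsHaggSeq s) (hp : ∀ k, s (k + p) = s k) :
    ∀ α ∈ transl hs hp, ∀ w : ℤ × ℤ × ℤ, chart (α w) = chart w + (chart (α ((0 : ℤ), (0 : ℤ), (0 : ℤ))) - chart ((0 : ℤ), (0 : ℤ), (0 : ℤ))) := by
  intro α hα w
  obtain ⟨c, a, b, rfl⟩ := (mem_transl hs hp).1 hα
  ext i
  fin_cases i <;> simp

/-- The chart is constant (`= 0`) on the transversal. [folklore] -/
theorem chart_reps : ∀ r ∈ reps p, ∀ r' ∈ reps p, chart r = chart r' := by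
  intro r hr r' hr'
  obtain ⟨m, -, rfl⟩ := mem_reps.1 hr
  obtain ⟨m', -, rfl⟩ := mem_reps.1 hr'
  rfl

/-- `1`-range along the contacts at the representatives (indeed along every contact: `Barlow.adj_bound`). [folklore] -/
theorem chart_lip (hs : IsHaggSeq s) :
    ∀ r ∈ reps p, ∀ w : ℤ × ℤ × ℤ, (contactGraph s).Adj r w → ∀ i : Fin 2, |chart w i - chart r i| ≤ ((1 : ℕ) : ℤ) := by
  intro r _ w h i
  obtain ⟨-, h2, h3⟩ := adj_bound hs h
  fin_cases i
  · simpa using h2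
  · simpa using h3

/-- **Exact unit steps along single contacts at every ball**: the in-layer contacts `(k, i ± 1, j)`, `(k, i, j ± 1)` (`∓(1,0), ∓(0,1) ∈ sixOffsets`). [this work] -/
theorem chart_step (hs : IsHaggSeq s) (v : ℤ × ℤ × ℤ) (i : Fin 2) (σ : ℤˣ) :
    ∃ w : ℤ × ℤ × ℤ, (contactGraph s).Adj v w ∧ chart w = chart v + Pi.single i (((1 : ℕ) : ℤ) * σ) := by
  obtain ⟨k, x, y⟩ := v
  rcases Int.units_eq_one_or σ with rfl | rfl <;> fin_cases i
  · refine ⟨(k, x + 1, y), ?_, ?_⟩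
    · rw [contactGraph_adj_iff hs]
      exact Or.inl ⟨rfl, by rw [show x - (x + 1) = -1 by ring, sub_self]; decide⟩
    · ext j; fin_cases j <;> simp
  · refine ⟨(k, x, y + 1), ?_, ?_⟩
    · rw [contactGraph_adj_iff hs]
      exact Or.inl ⟨rfl, by rw [show y - (y + 1) = -1 by ring, sub_self]; decide⟩
    · ext j; fin_cases j <;> simp
  · refine ⟨(k, x - 1, y), ?_, ?_⟩
    · rw [contactGraph_adj_iff hs]
      exact Or.inl ⟨rfl, by rw [show x - (x - 1) = 1 by ring, sub_self]; decide⟩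
    · ext j; fin_cases j <;> simp [sub_eq_add_neg]
  · refine ⟨(k, x, y - 1), ?_, ?_⟩
    · rw [contactGraph_adj_iff hs]
      exact Or.inl ⟨rfl, by rw [show y - (y - 1) = 1 by ring, sub_self]; decide⟩
    · ext j; fin_cases j <;> simp [sub_eq_add_neg]

/-! ## §4 `θ_v(p_c) = 0` on every periodic ideal stacking -/

/-- **THEOREM (unconditional).  `θ_v(p_c) = 0` at every ball of the contact graph of every PERIODIC ideal Barlow stacking** (`s` a Hägg sequence with
`s (k + p) = s k`, `0 < p`: the polytypes 2H = hcp, 3C = fcc, 4H = dhcp, 6H, 9R, …), by the orbit theorem with the `p` orbits (the layers mod `p`) of the translation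
subgroup `pℤ × ℤ² ≤ Aut`, chart = in-layer label, `N = 1`. builds on p205010 (kernel theorem, internal audit signed; external expert review pending).
[cite: BenjaminiSchramm1996, Conj. 4 (p. 75); §2 (almost transitive graphs)] [cite: ConwaySloane1999, Ch. 4 §6.1] [cite: KozmaNitzan2024, §4 p. 16 (Lemma 8)] -/
theorem criticalContinuity (hs : IsHaggSeq s) (hp0 : 0 < p) (hp : ∀ k, s (k + p) = s k) (v : ℤ × ℤ × ℤ) :
    theta (contactGraph s) v (criticalProbIOf (contactGraph s) v) = 0 := by
  haveI : Fact (IsHaggSeq s) := ⟨hs⟩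
  exact AutChart.criticalContinuity_of_autSubgroup_finite_orbits (connected hs) (transl hs hp) (reps p) (reps_trans hs hp)
    (reps_cover hs hp0 hp) chart (t := ((0 : ℤ), (0 : ℤ), (0 : ℤ))) (chart_transl hs hp) chart_reps 1 le_rfl (chart_lip hs)
    (fun r _ i σ => chart_step hs r i σ) v

/-- **Conj. 4 in its own shape on every periodic ideal stacking: `p_c < 1 ∧ θ_v(p_c) = 0`** at every ball (the §6 front-end `AutChart.conj4_of_autSubgroup_finite_orbits`;
`p_c < 1` was already `Barlow.criticalProb_lt_one`). builds on p205010 (kernel theorem, internal audit signed; external expert review pending).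
[cite: BenjaminiSchramm1996, Conj. 4; §2 Conj. 1] -/
theorem conj4 (hs : IsHaggSeq s) (hp0 : 0 < p) (hp : ∀ k, s (k + p) = s k) (v : ℤ × ℤ × ℤ) :
    criticalProb (contactGraph s) v < 1 ∧ theta (contactGraph s) v (criticalProbIOf (contactGraph s) v) = 0 := by
  haveI : Fact (IsHaggSeq s) := ⟨hs⟩
  exact AutChart.conj4_of_autSubgroup_finite_orbits (connected hs) (transl hs hp) (reps p) (reps_trans hs hp)
    (reps_cover hs hp0 hp) chart (t := ((0 : ℤ), (0 : ℤ), (0 : ℤ))) (chart_transl hs hp) chart_reps 1 le_rfl (chart_lip hs)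
    (fun r _ i σ => chart_step hs r i σ) v

/-- **… and the same-`p` drop at every ball**: every `q` with `θ_v(q) > 0` admits `q' < q` with `θ_v(q') > 0`. [cite: BenjaminiSchramm1996, Conj. 4] -/
theorem drop (hs : IsHaggSeq s) (hp0 : 0 < p) (hp : ∀ k, s (k + p) = s k) (v : ℤ × ℤ × ℤ) (q : unitInterval)
    (hθ : 0 < theta (contactGraph s) v q) : ∃ q' : unitInterval, (q' : ℝ) < q ∧ 0 < theta (contactGraph s) v q' :=
  drop_at_of_critical (contactGraph s) v (P := fun _ => True) (fun _ => criticalContinuity hs hp0 hp v) q trivial hθ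

end Barlow

/-! ## §5 TARGET 2t′ (periodic form) by name -/

/-- **THEOREM (TARGET 2t′, periodic form — UNCONDITIONAL IN THE TREE): `BarlowStackingCriticalContinuity`** — Bernoulli bond percolation on the contact graph of every
PERIODIC close-packed polytype (every periodic Hägg sequence: 2H = hcp, 3C = fcc, 4H = dhcp, 6H, 9R, …) has no infinite cluster at its own critical point, at every ball
(`Barlow.criticalContinuity`). builds on p205010 (kernel theorem, internal audit signed; external expert review pending).
[cite: BenjaminiSchramm1996, Conj. 4 (p. 75)] [cite: ConwaySloane1999, Ch. 1 §1.3 and Ch. 4 §6.1] -/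
theorem barlowStackingCriticalContinuity_holds : BarlowStackingCriticalContinuity := by
  intro s hs hper v
  obtain ⟨p, hp0, hp⟩ := hper
  exact Barlow.criticalContinuity hs hp0 hp v

end Summit.CriticalPhenomena.PercolationContinuityZ3.Theorems.Transplant

end
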